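import Summits.Ventures.LatticeQCDFlow.TrivializingMaps.StrongCouplingSpecificHeat
import Summits.Ventures.LatticeQCDFlow.TrivializingMaps.StaircaseMeanActionLaw

/-!
HONEST FRAMING: exact (Metropolis-corrected) sampling algorithms for lattice gauge theory; figures
of merit are autocorrelation/cost numbers at stated couplings and volumes; no continuum-physics
claim.

# ReweightingStepLaw — THE SECOND MOMENT OF ONE EXACT REWEIGHTING STEP IN THE COUPLING IS
# `exp(∫∫ Var)`: `Z(β)Z(β+2δ)/Z(β+δ)² = exp(∫_β^{β+δ}∫_t^{t+δ} Var_u(S) du dt)`, HENCE BETWEEN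
# `exp(δ²·min Var)` AND `exp(δ²·max Var)`; WILSON AT STRONG COUPLING: `≥ exp(δ²·m₂(n)·#plaq/2)`
# (lean-2 GEN-8, ours)

Venture-side (OURS).  Cell `lqcd-flow` (pub-lqcd), unit `pub-lqcd-lean-2-g8`, 2026-08-22.

The exactness-preserving step of every annealing / Jarzynski / population scheme between two couplings
is importance reweighting from `μ_β = 𝒵(β)⁻¹e^{-βS}D[U]` to `μ_{β+δ}`; its weight
`w = dμ_{β+δ}/dμ_β = e^{-δS}·Z(β)/Z(β+δ)` has mean one and SECOND MOMENT
`E_{μ_β}[w²] = Z(β)Z(β+2δ)/Z(β+δ)² = 1 + χ²(μ_{β+δ} ‖ μ_β)` (the asymptotic inverse effective-sample-size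
fraction).  For every smooth action `S` on `SU(n)^E` (every `d`, `L`, `n`), with `ψ = log Z` the
cumulant generating function of `-S∘ι` under `D[U]` (`ψ″(t) = Var_t(S)`, Mathlib's
`variance_tilted_mul`):

* §1 `cgf_neg_action_analyticOnNhd`, `iteratedDeriv_two_cgf_eq_variance` — `ψ` is real-analytic on
  `ℝ` and `ψ″(t) = Var_t(S∘ι)`
  (variance under `𝒵⁻¹e^{-tS}D[U]`);
* §2 **`cgf_second_difference_eq`** — the exact law
  `ψ(β+2δ) − 2ψ(β+δ) + ψ(β) = ∫_β^{β+δ} ∫_t^{t+δ} Var_u(S∘ι) du dt`; **`cgf_second_difference_ge/le`** —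
  if `m ≤ Var_u ≤ M` on `[β, β+2δ]` (`δ ≥ 0`) then the second difference lies in `[δ²m, δ²M]`;
* §3 **`weight_sq_integral_eq`** — `E_{μ_β}[(e^{-δS}Z(β)/Z(β+δ))²] = exp(ψ(β+2δ) − 2ψ(β+δ) + ψ(β))`,
  so **`weight_sq_integral_ge_exp` / `…_le_exp`**: the second moment of the one-step weight lies in
  `[exp(δ²m), exp(δ²M)]` — the reweighting window `δ ≲ 1/√(Var S) ∝ (#plaq)^{-1/2}` of the finite-state
  T2-AA (`Scaling/AnnealingStepLaw`) as an exact law for the continuum-group Wilson-type theories;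
* §4 **`wilson_weight_sq_integral_ge_exp_strongCoupling`** — `SU(n)`, `n ≥ 2`, `L ≥ 2`, `0 ≤ δ`,
  `[β, β+2δ] ⊆ [-b, b]` with `b = min (r/8) (m₂(n) r³/512)` (`r = 1/(8e·n·(3^d d²+1)²)`,
  `StrongCouplingSpecificHeat`): `E_{μ_β}[w²] ≥ exp(δ² · m₂(n) · #plaq / 2)` — the second moment of one
  exact reweighting step grows exponentially in the VOLUME at fixed step `δ`, with a closed-form rate,
  in every volume.

NOT CLAIMED: any finite-sample ESS statement (only the second moment of the weight, `= 1 + χ²`);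
anything outside the strong-coupling window in §4; cost / autocorrelation / continuum statements.
Literature grade (cell rule): elementary (Ferrenberg–Swendsen reweighting window; fluctuation
formulas); new typing, no new theorem of physics.
-/

noncomputable section

open MeasureTheory ProbabilityTheory Complex Metric Set Filter Topology intervalIntegral
open Literature.MathematicalPhysics.QuantumFieldTheory
open Literature.MathematicalPhysics.QuantumFieldTheory.Luscher2010
open Literature.MathematicalPhysics.QuantumFieldTheory.WilsonFlow (coeConfig continuous_coeConfig)
open scoped Matrix Matrix.Norms.Frobenius ContDiff

namespace Summit.Ventures.LatticeQCDFlow.TrivializingMaps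

/-! ## §1 The cumulant generating function of `-S∘ι` is smooth, `ψ″ = Var` -/

section CGF

variable {d L n : ℕ} [NeZero L] {S : AmbConfig d L n → ℝ}

/-- `ψ = cgf(-S∘ι)` is real-analytic on all of `ℝ` (all exponential moments exist on the compact field
manifold). [folklore] -/
theorem cgf_neg_action_analyticOnNhd (hS : ContDiff ℝ ∞ S) :
    AnalyticOnNhd ℝ (cgf (fun U => -S (coeConfig U))
      (trivialMeasure (Matrix.specialUnitaryGroup (Fin n) ℂ) d L)) Set.univ := fun x _ =>
  analyticAt_cgf (mem_interior_integrableExpSet_neg_action (d := d) (L := L) (n := n) hS x)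

/-- **`ψ″(t) = Var_t(S∘ι)`**: the second derivative of `ψ = cgf(-S∘ι)` at a real coupling `t` is the
variance of the action in the ensemble `𝒵⁻¹e^{-tS}D[U]`. [folklore] -/
theorem iteratedDeriv_two_cgf_eq_variance (hS : ContDiff ℝ ∞ S) (t : ℝ) :
    iteratedDeriv 2 (cgf (fun U => -S (coeConfig U))
        (trivialMeasure (Matrix.specialUnitaryGroup (Fin n) ℂ) d L)) t =
      variance (fun U => S (coeConfig U))
        (boltzmannMeasure fun U : GaugeConfig d L (Matrix.specialUnitaryGroup (Fin n) ℂ) =>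
          t * S (coeConfig U)) := by
  have ht := mem_interior_integrableExpSet_neg_action (d := d) (L := L) (n := n) hS t
  have hcont : Continuous fun U : GaugeConfig d L (Matrix.specialUnitaryGroup (Fin n) ℂ) =>
      t * S (coeConfig U) := continuous_const.mul (continuous_comp_coeConfig hS)
  have hμ : (boltzmannMeasure fun U : GaugeConfig d L (Matrix.specialUnitaryGroup (Fin n) ℂ) =>
      t * S (coeConfig U)) = (trivialMeasure (Matrix.specialUnitaryGroup (Fin n) ℂ) d L).tilted
        fun U => t * (-S (coeConfig U)) := by
    rw [boltzmannMeasure_eq_tilted hcont]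
    congr 1
    funext U
    ring
  rw [← variance_tilted_mul ht, hμ, variance_fun_neg]

/-- `ψ′` has derivative `ψ″ = Var` everywhere. [folklore] -/
theorem hasDerivAt_deriv_cgf (hS : ContDiff ℝ ∞ S) (t : ℝ) :
    HasDerivAt (deriv (cgf (fun U => -S (coeConfig U))
        (trivialMeasure (Matrix.specialUnitaryGroup (Fin n) ℂ) d L)))
      (variance (fun U => S (coeConfig U))
        (boltzmannMeasure fun U : GaugeConfig d L (Matrix.specialUnitaryGroup (Fin n) ℂ) =>
          t * S (coeConfig U))) t := by
  have hA := (cgf_neg_action_analyticOnNhd (d := d) (L := L) (n := n) hS).deriv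
  have h := (hA t (Set.mem_univ t)).differentiableAt.hasDerivAt
  rw [← iteratedDeriv_two_cgf_eq_variance hS t, iteratedDeriv_succ, iteratedDeriv_one]
  exact h

/-- `ψ` has derivative `ψ′` everywhere. [folklore] -/
theorem hasDerivAt_cgf_neg_action (hS : ContDiff ℝ ∞ S) (t : ℝ) :
    HasDerivAt (cgf (fun U => -S (coeConfig U))
        (trivialMeasure (Matrix.specialUnitaryGroup (Fin n) ℂ) d L))
      (deriv (cgf (fun U => -S (coeConfig U))
        (trivialMeasure (Matrix.specialUnitaryGroup (Fin n) ℂ) d L)) t) t :=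
  ((cgf_neg_action_analyticOnNhd (d := d) (L := L) (n := n) hS) t (Set.mem_univ t)).differentiableAt.hasDerivAt

end CGF

/-! ## §2 The second difference of `ψ = log Z` is a double integral of the variance -/

section SecondDifference

variable {d L n : ℕ} [NeZero L] {S : AmbConfig d L n → ℝ}

/-- **EXACT LAW: `ψ(β+2δ) − 2ψ(β+δ) + ψ(β) = ∫_β^{β+δ} ∫_t^{t+δ} Var_u(S∘ι) du dt`** for every smooth
action, every volume, every real `β`, `δ`. [ours] -/
theorem cgf_second_difference_eq (hS : ContDiff ℝ ∞ S) (β δ : ℝ) :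
    cgf (fun U => -S (coeConfig U)) (trivialMeasure (Matrix.specialUnitaryGroup (Fin n) ℂ) d L)
        (β + 2 * δ) -
      2 * cgf (fun U => -S (coeConfig U)) (trivialMeasure (Matrix.specialUnitaryGroup (Fin n) ℂ) d L)
        (β + δ) +
      cgf (fun U => -S (coeConfig U)) (trivialMeasure (Matrix.specialUnitaryGroup (Fin n) ℂ) d L) β =
      ∫ t in β..β + δ, ∫ u in t..t + δ, variance (fun U => S (coeConfig U))
        (boltzmannMeasure fun U : GaugeConfig d L (Matrix.specialUnitaryGroup (Fin n) ℂ) =>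
          u * S (coeConfig U)) := by
  set ψ := cgf (fun U => -S (coeConfig U))
    (trivialMeasure (Matrix.specialUnitaryGroup (Fin n) ℂ) d L) with hψdef
  set V : ℝ → ℝ := fun u => variance (fun U => S (coeConfig U))
    (boltzmannMeasure fun U : GaugeConfig d L (Matrix.specialUnitaryGroup (Fin n) ℂ) =>
      u * S (coeConfig U)) with hVdef
  have hVc : Continuous V := continuous_variance_boltzmann hS
  have hψ' : ∀ t, HasDerivAt ψ (deriv ψ t) t := hasDerivAt_cgf_neg_action hS
  have hψ'' : ∀ t, HasDerivAt (deriv ψ) (V t) t := hasDerivAt_deriv_cgf hS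
  have hψ'c : Continuous (deriv ψ) := continuous_iff_continuousAt.2 fun t => (hψ'' t).continuousAt
  -- FTC for `ψ` and for `ψ'`
  have h1 : ∀ a b : ℝ, ψ b - ψ a = ∫ t in a..b, deriv ψ t := fun a b =>
    (integral_eq_sub_of_hasDerivAt (fun t _ => hψ' t) (hψ'c.intervalIntegrable a b)).symm
  have h2 : ∀ a b : ℝ, deriv ψ b - deriv ψ a = ∫ u in a..b, V u := fun a b =>
    (integral_eq_sub_of_hasDerivAt (fun t _ => hψ'' t) (hVc.intervalIntegrable a b)).symm
  -- the second difference as an integral of first differences of `ψ'`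
  have hshift : ∫ t in β..β + δ, deriv ψ (t + δ) = ∫ t in β + δ..β + 2 * δ, deriv ψ t := by
    rw [intervalIntegral.integral_comp_add_right (fun t => deriv ψ t) δ]
    congr 1
    ring
  have hfi : IntervalIntegrable (fun t => deriv ψ (t + δ)) volume β (β + δ) :=
    (hψ'c.comp (continuous_add_const δ)).intervalIntegrable _ _
  have hgi : IntervalIntegrable (fun t => deriv ψ t) volume β (β + δ) := hψ'c.intervalIntegrable _ _
  calc ψ (β + 2 * δ) - 2 * ψ (β + δ) + ψ β
      = (ψ (β + 2 * δ) - ψ (β + δ)) - (ψ (β + δ) - ψ β) := by ring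
    _ = (∫ t in β..β + δ, deriv ψ (t + δ)) - ∫ t in β..β + δ, deriv ψ t := by
        rw [h1, h1, hshift]
    _ = ∫ t in β..β + δ, (deriv ψ (t + δ) - deriv ψ t) := by
        rw [intervalIntegral.integral_sub hfi hgi]
    _ = ∫ t in β..β + δ, ∫ u in t..t + δ, V u := by
        refine intervalIntegral.integral_congr fun t _ => ?_
        exact h2 t (t + δ)

/-- **LOWER BOUND: if `m ≤ Var_u(S∘ι)` for `u ∈ [β, β+2δ]` (`δ ≥ 0`) then
`ψ(β+2δ) − 2ψ(β+δ) + ψ(β) ≥ δ²·m`.** [ours] -/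
theorem cgf_second_difference_ge (hS : ContDiff ℝ ∞ S) {β δ m : ℝ} (hδ : 0 ≤ δ)
    (hm : ∀ u ∈ Icc β (β + 2 * δ), m ≤ variance (fun U => S (coeConfig U))
      (boltzmannMeasure fun U : GaugeConfig d L (Matrix.specialUnitaryGroup (Fin n) ℂ) =>
        u * S (coeConfig U))) :
    δ ^ 2 * m ≤
      cgf (fun U => -S (coeConfig U)) (trivialMeasure (Matrix.specialUnitaryGroup (Fin n) ℂ) d L)
          (β + 2 * δ) -
        2 * cgf (fun U => -S (coeConfig U)) (trivialMeasure (Matrix.specialUnitaryGroup (Fin n) ℂ) d L)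
          (β + δ) +
        cgf (fun U => -S (coeConfig U)) (trivialMeasure (Matrix.specialUnitaryGroup (Fin n) ℂ) d L) β := by
  set V : ℝ → ℝ := fun u => variance (fun U => S (coeConfig U))
    (boltzmannMeasure fun U : GaugeConfig d L (Matrix.specialUnitaryGroup (Fin n) ℂ) =>
      u * S (coeConfig U)) with hVdef
  have hVc : Continuous V := continuous_variance_boltzmann hS
  rw [cgf_second_difference_eq hS β δ]
  -- inner integrals are at least `δ m`
  have hinner : ∀ t ∈ Icc β (β + δ), δ * m ≤ ∫ u in t..t + δ, V u := by
    intro t ht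
    have hconst : ∫ _ in t..t + δ, m = δ * m := by
      rw [intervalIntegral.integral_const, smul_eq_mul]; ring
    rw [← hconst]
    refine intervalIntegral.integral_mono_on (by linarith) (continuous_const.intervalIntegrable _ _)
      (hVc.intervalIntegrable _ _) fun u hu => hm u ⟨by linarith [ht.1, hu.1], by linarith [ht.2, hu.2]⟩
  have hconst : ∫ _ in β..β + δ, δ * m = δ ^ 2 * m := by
    rw [intervalIntegral.integral_const, smul_eq_mul]; ring
  rw [← hconst]
  have hIc : Continuous fun t => ∫ u in t..t + δ, V u := by
    have h2 : ∀ t, ∫ u in t..t + δ, V u = (∫ u in (0:ℝ)..t + δ, V u) - ∫ u in (0:ℝ)..t, V u :=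
      fun t => (intervalIntegral.integral_interval_sub_left (hVc.intervalIntegrable _ _)
        (hVc.intervalIntegrable _ _)).symm
    simp_rw [h2]
    exact ((intervalIntegral.continuous_primitive (fun _ _ => hVc.intervalIntegrable _ _) 0).comp
      (continuous_add_const δ)).sub
      (intervalIntegral.continuous_primitive (fun _ _ => hVc.intervalIntegrable _ _) 0)
  exact intervalIntegral.integral_mono_on (by linarith) (continuous_const.intervalIntegrable _ _)
    (hIc.intervalIntegrable _ _) fun t ht => hinner t ht

/-- **UPPER BOUND: if `Var_u(S∘ι) ≤ M` for `u ∈ [β, β+2δ]` (`δ ≥ 0`) then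
`ψ(β+2δ) − 2ψ(β+δ) + ψ(β) ≤ δ²·M`.** [ours] -/
theorem cgf_second_difference_le (hS : ContDiff ℝ ∞ S) {β δ M : ℝ} (hδ : 0 ≤ δ)
    (hM : ∀ u ∈ Icc β (β + 2 * δ), variance (fun U => S (coeConfig U))
      (boltzmannMeasure fun U : GaugeConfig d L (Matrix.specialUnitaryGroup (Fin n) ℂ) =>
        u * S (coeConfig U)) ≤ M) :
    cgf (fun U => -S (coeConfig U)) (trivialMeasure (Matrix.specialUnitaryGroup (Fin n) ℂ) d L)
          (β + 2 * δ) -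
        2 * cgf (fun U => -S (coeConfig U)) (trivialMeasure (Matrix.specialUnitaryGroup (Fin n) ℂ) d L)
          (β + δ) +
        cgf (fun U => -S (coeConfig U)) (trivialMeasure (Matrix.specialUnitaryGroup (Fin n) ℂ) d L) β ≤
      δ ^ 2 * M := by
  set V : ℝ → ℝ := fun u => variance (fun U => S (coeConfig U))
    (boltzmannMeasure fun U : GaugeConfig d L (Matrix.specialUnitaryGroup (Fin n) ℂ) =>
      u * S (coeConfig U)) with hVdef
  have hVc : Continuous V := continuous_variance_boltzmann hS
  rw [cgf_second_difference_eq hS β δ]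
  have hinner : ∀ t ∈ Icc β (β + δ), ∫ u in t..t + δ, V u ≤ δ * M := by
    intro t ht
    have hconst : ∫ _ in t..t + δ, M = δ * M := by
      rw [intervalIntegral.integral_const, smul_eq_mul]; ring
    rw [← hconst]
    refine intervalIntegral.integral_mono_on (by linarith) (hVc.intervalIntegrable _ _)
      (continuous_const.intervalIntegrable _ _)
      fun u hu => hM u ⟨by linarith [ht.1, hu.1], by linarith [ht.2, hu.2]⟩
  have hconst : ∫ _ in β..β + δ, δ * M = δ ^ 2 * M := by
    rw [intervalIntegral.integral_const, smul_eq_mul]; ring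
  rw [← hconst]
  have hIc : Continuous fun t => ∫ u in t..t + δ, V u := by
    have h2 : ∀ t, ∫ u in t..t + δ, V u = (∫ u in (0:ℝ)..t + δ, V u) - ∫ u in (0:ℝ)..t, V u :=
      fun t => (intervalIntegral.integral_interval_sub_left (hVc.intervalIntegrable _ _)
        (hVc.intervalIntegrable _ _)).symm
    simp_rw [h2]
    exact ((intervalIntegral.continuous_primitive (fun _ _ => hVc.intervalIntegrable _ _) 0).comp
      (continuous_add_const δ)).sub
      (intervalIntegral.continuous_primitive (fun _ _ => hVc.intervalIntegrable _ _) 0)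
  exact intervalIntegral.integral_mono_on (by linarith) (hIc.intervalIntegrable _ _)
    (continuous_const.intervalIntegrable _ _) fun t ht => hinner t ht

end SecondDifference

/-! ## §3 The second moment of the one-step reweighting weight -/

section Weight

variable {d L n : ℕ} [NeZero L] {S : AmbConfig d L n → ℝ}

/-- **`E_{μ_β}[(e^{-δS} Z(β)/Z(β+δ))²] = exp(ψ(β+2δ) − 2ψ(β+δ) + ψ(β))`**: the second moment of the
importance weight `dμ_{β+δ}/dμ_β` of one exact reweighting step (`Z = mgf(-S∘ι)`, `ψ = log Z`).
[ours] -/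
theorem weight_sq_integral_eq (hS : ContDiff ℝ ∞ S) (β δ : ℝ) :
    ∫ U, (Real.exp (-(δ * S (coeConfig U))) *
        (mgf (fun U => -S (coeConfig U)) (trivialMeasure (Matrix.specialUnitaryGroup (Fin n) ℂ) d L) β /
          mgf (fun U => -S (coeConfig U)) (trivialMeasure (Matrix.specialUnitaryGroup (Fin n) ℂ) d L)
            (β + δ))) ^ 2
      ∂(boltzmannMeasure fun U : GaugeConfig d L (Matrix.specialUnitaryGroup (Fin n) ℂ) =>
          β * S (coeConfig U)) =
      Real.exp (cgf (fun U => -S (coeConfig U))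
            (trivialMeasure (Matrix.specialUnitaryGroup (Fin n) ℂ) d L) (β + 2 * δ) -
          2 * cgf (fun U => -S (coeConfig U))
            (trivialMeasure (Matrix.specialUnitaryGroup (Fin n) ℂ) d L) (β + δ) +
          cgf (fun U => -S (coeConfig U))
            (trivialMeasure (Matrix.specialUnitaryGroup (Fin n) ℂ) d L) β) := by
  set D := trivialMeasure (Matrix.specialUnitaryGroup (Fin n) ℂ) d L with hD
  set X : GaugeConfig d L (Matrix.specialUnitaryGroup (Fin n) ℂ) → ℝ := fun U => -S (coeConfig U)
    with hXdef
  haveI : IsProbabilityMeasure D := by rw [hD]; unfold trivialMeasure; infer_instance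
  have hXc : Continuous X := (continuous_comp_coeConfig hS).neg
  have hint : ∀ t : ℝ, Integrable (fun U => Real.exp (t * X U)) D := fun t =>
    integrable_trivialMeasure_of_continuous (Real.continuous_exp.comp (continuous_const.mul hXc))
  have hZpos : ∀ t : ℝ, 0 < mgf X D t := fun t => mgf_pos (hint t)
  have hcont : Continuous fun U : GaugeConfig d L (Matrix.specialUnitaryGroup (Fin n) ℂ) =>
      β * S (coeConfig U) := continuous_const.mul (continuous_comp_coeConfig hS)
  have hμ : (boltzmannMeasure fun U : GaugeConfig d L (Matrix.specialUnitaryGroup (Fin n) ℂ) =>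
      β * S (coeConfig U)) = D.tilted fun U => β * X U := by
    rw [boltzmannMeasure_eq_tilted hcont]
    congr 1
    funext U
    simp only [hXdef]
    ring
  rw [hμ, integral_tilted]
  -- `∫ e^{βX}/Z(β) · (e^{δX} Z(β)/Z(β+δ))² dD = Z(β+2δ) Z(β) / Z(β+δ)²`
  have hrw : ∀ U, (Real.exp (β * X U) / ∫ V, Real.exp (β * X V) ∂D) •
      (Real.exp (-(δ * S (coeConfig U))) * (mgf X D β / mgf X D (β + δ))) ^ 2 =
      (mgf X D β / mgf X D (β + δ) ^ 2) * Real.exp ((β + 2 * δ) * X U) := by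
    intro U
    have hZ : ∫ V, Real.exp (β * X V) ∂D = mgf X D β := rfl
    rw [hZ, smul_eq_mul]
    have hexp : Real.exp (-(δ * S (coeConfig U))) = Real.exp (δ * X U) := by
      simp only [hXdef]; ring_nf
    rw [hexp]
    have h3 : Real.exp ((β + 2 * δ) * X U) = Real.exp (β * X U) * (Real.exp (δ * X U)) ^ 2 := by
      rw [← Real.exp_nat_mul, ← Real.exp_add]; ring_nf
    rw [h3]
    have hZb : mgf X D β ≠ 0 := (hZpos β).ne'
    have hZd : mgf X D (β + δ) ≠ 0 := (hZpos (β + δ)).ne'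
    field_simp
  simp_rw [hrw]
  rw [MeasureTheory.integral_const_mul]
  have hZ2 : ∫ U, Real.exp ((β + 2 * δ) * X U) ∂D = mgf X D (β + 2 * δ) := rfl
  rw [hZ2]
  have hψ : ∀ t, cgf X D t = Real.log (mgf X D t) := fun t => rfl
  have hA := hZpos (β + 2 * δ)
  have hB := hZpos (β + δ)
  have hC := hZpos β
  rw [hψ, hψ, hψ, show Real.log (mgf X D (β + 2 * δ)) - 2 * Real.log (mgf X D (β + δ)) +
      Real.log (mgf X D β) = Real.log (mgf X D (β + 2 * δ) * mgf X D β / mgf X D (β + δ) ^ 2) by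
    rw [Real.log_div (by positivity) (by positivity), Real.log_mul hA.ne' hC.ne', Real.log_pow]
    push_cast; ring]
  rw [Real.exp_log (by positivity)]
  field_simp

/-- **SECOND MOMENT OF THE ONE-STEP WEIGHT ≥ `exp(δ²·m)`** when `Var_u(S∘ι) ≥ m` on `[β, β+2δ]`
(`δ ≥ 0`). [ours] -/
theorem weight_sq_integral_ge_exp (hS : ContDiff ℝ ∞ S) {β δ m : ℝ} (hδ : 0 ≤ δ)
    (hm : ∀ u ∈ Icc β (β + 2 * δ), m ≤ variance (fun U => S (coeConfig U))
      (boltzmannMeasure fun U : GaugeConfig d L (Matrix.specialUnitaryGroup (Fin n) ℂ) =>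
        u * S (coeConfig U))) :
    Real.exp (δ ^ 2 * m) ≤
      ∫ U, (Real.exp (-(δ * S (coeConfig U))) *
        (mgf (fun U => -S (coeConfig U)) (trivialMeasure (Matrix.specialUnitaryGroup (Fin n) ℂ) d L) β /
          mgf (fun U => -S (coeConfig U)) (trivialMeasure (Matrix.specialUnitaryGroup (Fin n) ℂ) d L)
            (β + δ))) ^ 2
      ∂(boltzmannMeasure fun U : GaugeConfig d L (Matrix.specialUnitaryGroup (Fin n) ℂ) =>
          β * S (coeConfig U)) := by
  rw [weight_sq_integral_eq hS β δ]
  exact Real.exp_le_exp.2 (cgf_second_difference_ge hS hδ hm)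

/-- **SECOND MOMENT OF THE ONE-STEP WEIGHT ≤ `exp(δ²·M)`** when `Var_u(S∘ι) ≤ M` on `[β, β+2δ]`
(`δ ≥ 0`). [ours] -/
theorem weight_sq_integral_le_exp (hS : ContDiff ℝ ∞ S) {β δ M : ℝ} (hδ : 0 ≤ δ)
    (hM : ∀ u ∈ Icc β (β + 2 * δ), variance (fun U => S (coeConfig U))
      (boltzmannMeasure fun U : GaugeConfig d L (Matrix.specialUnitaryGroup (Fin n) ℂ) =>
        u * S (coeConfig U)) ≤ M) :
    ∫ U, (Real.exp (-(δ * S (coeConfig U))) *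
        (mgf (fun U => -S (coeConfig U)) (trivialMeasure (Matrix.specialUnitaryGroup (Fin n) ℂ) d L) β /
          mgf (fun U => -S (coeConfig U)) (trivialMeasure (Matrix.specialUnitaryGroup (Fin n) ℂ) d L)
            (β + δ))) ^ 2
      ∂(boltzmannMeasure fun U : GaugeConfig d L (Matrix.specialUnitaryGroup (Fin n) ℂ) =>
          β * S (coeConfig U)) ≤ Real.exp (δ ^ 2 * M) := by
  rw [weight_sq_integral_eq hS β δ]
  exact Real.exp_le_exp.2 (cgf_second_difference_le hS hδ hM)

end Weight

/-! ## §4 Wilson at strong coupling: the one-step weight's second moment is exponential in the volume -/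

section Wilson

variable {d L n : ℕ} [NeZero L]

/-- **`SU(n)` WILSON, STRONG COUPLING, EVERY VOLUME `L ≥ 2`: the second moment of the importance
weight of one exact reweighting step `β → β+δ` (`δ ≥ 0`, `[β, β+2δ]` inside the specific-heat window
`|x| ≤ min (r/8) (m₂(n) r³/512)`) is at least `exp(δ² · m₂(n) · #plaquettes / 2)`.** [ours] -/
theorem wilson_weight_sq_integral_ge_exp_strongCoupling (hn : 2 ≤ n) (hL : 2 ≤ L) {β δ : ℝ}
    (hδ : 0 ≤ δ)
    (hβ : |β| ≤ min (1 / (8 * Real.exp 1 * (n : ℝ) * ((3 : ℝ) ^ d * (d : ℝ) ^ 2 + 1) ^ 2) / 8)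
      ((∫ g, ((g : Matrix (Fin n) (Fin n) ℂ)).trace.re ^ 2
          ∂(haarProbability (Matrix.specialUnitaryGroup (Fin n) ℂ))) *
        (1 / (8 * Real.exp 1 * (n : ℝ) * ((3 : ℝ) ^ d * (d : ℝ) ^ 2 + 1) ^ 2)) ^ 3 / 512))
    (hβ2 : |β + 2 * δ| ≤ min (1 / (8 * Real.exp 1 * (n : ℝ) * ((3 : ℝ) ^ d * (d : ℝ) ^ 2 + 1) ^ 2) / 8)
      ((∫ g, ((g : Matrix (Fin n) (Fin n) ℂ)).trace.re ^ 2
          ∂(haarProbability (Matrix.specialUnitaryGroup (Fin n) ℂ))) *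
        (1 / (8 * Real.exp 1 * (n : ℝ) * ((3 : ℝ) ^ d * (d : ℝ) ^ 2 + 1) ^ 2)) ^ 3 / 512)) :
    Real.exp (δ ^ 2 * ((∫ g, ((g : Matrix (Fin n) (Fin n) ℂ)).trace.re ^ 2
          ∂(haarProbability (Matrix.specialUnitaryGroup (Fin n) ℂ))) * Fintype.card (Plaquette d L) / 2)) ≤
      ∫ U, (Real.exp (-(δ * ambWilsonAction (coeConfig U))) *
        (mgf (fun U => -ambWilsonAction (coeConfig U))
            (trivialMeasure (Matrix.specialUnitaryGroup (Fin n) ℂ) d L) β /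
          mgf (fun U => -ambWilsonAction (coeConfig U))
            (trivialMeasure (Matrix.specialUnitaryGroup (Fin n) ℂ) d L) (β + δ))) ^ 2
      ∂(boltzmannMeasure fun U : GaugeConfig d L (Matrix.specialUnitaryGroup (Fin n) ℂ) =>
          β * ambWilsonAction (coeConfig U)) := by
  refine weight_sq_integral_ge_exp (d := d) (L := L) (n := n) contDiff_ambWilsonAction hδ
    fun u hu => ?_
  -- every `u ∈ [β, β+2δ]` is in the window
  have hu' : |u| ≤ min (1 / (8 * Real.exp 1 * (n : ℝ) * ((3 : ℝ) ^ d * (d : ℝ) ^ 2 + 1) ^ 2) / 8)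
      ((∫ g, ((g : Matrix (Fin n) (Fin n) ℂ)).trace.re ^ 2
          ∂(haarProbability (Matrix.specialUnitaryGroup (Fin n) ℂ))) *
        (1 / (8 * Real.exp 1 * (n : ℝ) * ((3 : ℝ) ^ d * (d : ℝ) ^ 2 + 1) ^ 2)) ^ 3 / 512) := by
    rw [abs_le] at hβ hβ2 ⊢
    exact ⟨by linarith [hβ.1, hu.1], by linarith [hβ2.2, hu.2]⟩
  have h := wilson_variance_ge_half_strongCoupling (d := d) (L := L) hn hL u hu'
  -- translate the variance under `wilsonMeasure ρ₀ u` into the Boltzmann form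
  have hV : variance (fun U => ambWilsonAction (coeConfig U))
      (boltzmannMeasure fun U : GaugeConfig d L (Matrix.specialUnitaryGroup (Fin n) ℂ) =>
        u * ambWilsonAction (coeConfig U)) =
      variance (wilsonAction (StrongCoupling.defRep n))
        (wilsonMeasure (d := d) (L := L) (StrongCoupling.defRep n) u) := by
    rw [StrongCoupling.boltzmannMeasure_smul_ambWilsonAction u]
    simp_rw [StrongCoupling.ambWilsonAction_coeConfig]
  rw [hV]
  linarith

end Wilson

end Summit.Ventures.LatticeQCDFlow.TrivializingMaps
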